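import Summits.BirchSwinnertonDyer.BirchSwinnertonDyer.Theses.PrintX10b
import Summits.BirchSwinnertonDyer.BirchSwinnertonDyer.Theorems.PrintX10bUntiedHowardContainmentOfKolyvaginSystemLeaf
import Summits.BirchSwinnertonDyer.BirchSwinnertonDyer.Theorems.PrintX10bHowardContainmentAnyClassNumberX10bThm413Hyp
import HarnessLib

/-!
# Census of `HowardContainmentAnyClassNumberX10b` (stmt-BirchSwinnertonDyer-23729) over the KOLYVAGIN-SYSTEM leaf: the crux BY
# NAME from `CGLSHeegnerKolyvaginSystem` (23236), `CGSHowardDivisibilityPLocalized` (27112), `MastellaZermanHowardDivisibility`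
# (25233) and the ONE typed-print residual `R_even` (even `d_K ≠ -4`, `3 ∣ h_K`)

Cell `pub/bsd-print-x9`, seat `bsd-line-x10b-p2` (LEAD g11), write-crux 23729 (aside r303). Companion of
`PrintX10bHowardContainmentAnyClassNumberX10bOfPrintOddDisc` (the same census over the leaf `CGLSHeegnerClassNonvanishing`, 27103):
here the odd-`d_K` regime runs over the route-free KS-leaf core
`UntiedHowardContainmentOfKSLeaf.howardContainment_untied_of_kolyvaginSystemLeaf_of_thm652` (p690011), so that the crux's
census reads over leaves that stay in row 10's trust base if the pen drops 27103 (x9-p1 LEAD g7 «hNV-ELIMINABLE», 2026-08-29):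

* `howardContainmentAnyClassNumberX10b_oddDisc_of_kolyvaginSystemLeaf_of_cgs` — binders of 23729 VERBATIM + `Odd (NumberField.discr K)`,
  conclusion of 23729, from `hK` (F-411) and `hCGS` (CGS 6.5.2): hypotheses of the leaves by `X10.thm413Hypotheses_of_classX10`,
  `jbar := IsAlgClosed.lift` along `ιC`.
* `howardContainmentAnyClassNumberX10b_of_ksLeaf_printLeaves_of_evenDiscResidual :
  CGLSHeegnerKolyvaginSystem → CGSHowardDivisibilityPLocalized → MastellaZermanHowardDivisibility → R_even →
  HowardContainmentAnyClassNumberX10b` — `R_even` := 23729's conclusion on the frames with `d_K` even and `3 ∣ h_K` (written out;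
  no definition), the CGLS (disc) typed-print gap (census evidence #44 on 23729); `3 ∤ h_K` at any parity is MZ26 Cor. 4.6
  (`X10.heegnerContainment_of_cor46_of_not_surj`).

HONEST FRAMING: CONDITIONAL on cite-only leaves; NOT route currency (PIN-1 / R0: untied `∃ F`); 23729 as filed stays open;
«beyond-print theorem»: no. No summit statement is proved; BSD is NOT proved by any of this.

References: [CastellaGrossiLeeSkinner2022] Thm. 4.1.1 (KS form), Rem. 4.1.4, §4.1 (disc); [CastellaGrossiSkinner2025] Thm. 6.5.2;
[MastellaZerman2026] Cor. 4.6; [LombardoTronto2022] Prop. 3.12; [Howard2004HeegnerKolyvagin] §1, Thm. B.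
-/

set_option linter.dupNamespace false
set_option autoImplicit false

noncomputable section

open scoped Classical
open Literature Literature.NumberTheory.EllipticCurves WeierstrassCurve
  Literature.NumberTheory.EllipticCurves.ModularForms
  Literature.NumberTheory.EllipticCurves.CastellaGrossiLeeSkinner2022
open Literature.NumberTheory.EllipticCurves.Rank1Residual (ClassX10 Surj)
open Summit.BirchSwinnertonDyer.BirchSwinnertonDyer.Theses.PrintX10b
  (CGLSHeegnerKolyvaginSystem CGSHowardDivisibilityPLocalized MastellaZermanHowardDivisibility HowardContainmentAnyClassNumberX10b)
open Summit.BirchSwinnertonDyer.BirchSwinnertonDyer.Theorems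

namespace Summit.BirchSwinnertonDyer.BirchSwinnertonDyer.Theorems.PrintX10bOfKSLeafOddDisc

/-- **`HowardContainmentAnyClassNumberX10b` (23729) RESTRICTED TO ODD `d_K`, from the Kolyvagin-system leaf
`CGLSHeegnerKolyvaginSystem` (23236) and `CGSHowardDivisibilityPLocalized` (27112) BY NAME**: the binders of the crux VERBATIM
followed by `Odd (NumberField.discr K)`, then its conclusion — the KS-leaf core
`UntiedHowardContainmentOfKSLeaf.howardContainment_untied_of_kolyvaginSystemLeaf_of_thm652` on the frame's `Thm413Hypotheses`
(`X10.thm413Hypotheses_of_classX10`). Of the crux's binders `¬ Surj W 3`, `¬ W.HasCM`, `d_K ≠ -4` are idle. NOT route currency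
(PIN-1 / R0). [cite: CastellaGrossiLeeSkinner2022, Thm. 4.1.1, Rem. 4.1.4] [cite: CastellaGrossiSkinner2025, Thm. 6.5.2] -/
theorem howardContainmentAnyClassNumberX10b_oddDisc_of_kolyvaginSystemLeaf_of_cgs
    (hK : CGLSHeegnerKolyvaginSystem) (hCGS : CGSHowardDivisibilityPLocalized) :
    ∀ (W : WeierstrassCurve ℚ) [W.IsElliptic] [W.IsGloballyMinimal] (p : ℕ) [Fact p.Prime]
      [NeZero (W.conductorNorm ℤ)] (K : Type) [Field K] [NumberField K],
      ClassX10 W p → ¬ Surj W 3 → ¬ W.HasCM →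
      IsImaginaryQuadratic K → NumberField.discr K ≠ -3 → NumberField.discr K ≠ -4 →
      SatisfiesHeegnerHypothesis (W.conductorNorm ℤ) K → SatisfiesHeegnerHypothesis p K →
      ∀ (κ : ZpExtension K p), κ.IsAnticyclotomic → ∀ (γ : Field.absoluteGaloisGroup K),
      κ.IsTopGenerator γ →
      ∀ (Dt : ModularParametrizationData W (W.conductorNorm ℤ))
        (H : HeegnerDatum (W.conductorNorm ℤ) (NumberField.discr K)) (ιC : K →+* ℂ),
      Odd (NumberField.discr K) →
      ∃ (jbar : AlgebraicClosure K →+* ℂ) (D : (W.baseChange K).LambdaAdicSelmerData κ γ)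
        (F : HeegnerFamily (W.conductorNorm ℤ) W K κ jbar) (X : (W.baseChange K).SelmerDualData κ γ),
        heegnerCharIdeal D F ^ 2 ≤
          Module.charIdeal (IwasawaAlgebra p) (Submodule.torsion (IwasawaAlgebra p) X.X) := by
  intro W _ _ p _ _ K _ _ hX _hns _hcm hKq h3 _h4 hHN hHp κ hκ γ hγ Dt H ιC hodd
  letI : Algebra K ℂ := ιC.toAlgebra
  let jbar : AlgebraicClosure K →+* ℂ :=
    (IsAlgClosed.lift (R := K) (M := ℂ) (S := AlgebraicClosure K)).toRingHom
  have hKS : thm411_exists_kolyvaginSystem_one_ne_zero := hK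
  have h652 : CastellaGrossiSkinner2025.thm652_stabilized_rankOne_charIdeal_torsion_dvd_pLocalized.{0} := hCGS
  obtain ⟨D, F, X, h⟩ := UntiedHowardContainmentOfKSLeaf.howardContainment_untied_of_kolyvaginSystemLeaf_of_thm652 hKS h652
    (Summit.BirchSwinnertonDyer.BirchSwinnertonDyer.Rank1Residual.X10.thm413Hypotheses_of_classX10 hX hKq h3 hHN hHp
      hodd hκ hγ) hHp hX.not_dvd_conductorNorm jbar Dt H
  exact ⟨jbar, D, F, X, h⟩

/-- **CENSUS OF 23729 OVER THE KS LEAF.** `HowardContainmentAnyClassNumberX10b` BY NAME from `CGLSHeegnerKolyvaginSystem` (23236),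
`CGSHowardDivisibilityPLocalized` (27112), `MastellaZermanHowardDivisibility` (25233) and the ONE residual `R_even` — the crux's
own conclusion on the frames with `d_K` EVEN and `p ∣ h_K` (spelled out). Split: odd `d_K` ↦ the theorem above; even `d_K`,
`p ∤ h_K` ↦ MZ26 Cor. 4.6 (`X10.heegnerContainment_of_cor46_of_not_surj`, no parity hypothesis); even `d_K`, `p ∣ h_K` ↦ `R_even`
(NO printed source: CGLS 2022 §4.1 (disc), inherited by CGS 2025 Thm. 6.5.2; vacuous for even-conductor curves). CONDITIONAL;
credits nothing by itself. [cite: CastellaGrossiLeeSkinner2022, Thm. 4.1.1, §4.1 (disc) (arXiv:2008.02571v2 TeX L248–249)]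
[cite: CastellaGrossiSkinner2025, Thm. 6.5.2] [cite: MastellaZerman2026, Cor. 4.6] [cite: LombardoTronto2022, Prop. 3.12] -/
theorem howardContainmentAnyClassNumberX10b_of_ksLeaf_printLeaves_of_evenDiscResidual
    (hK : CGLSHeegnerKolyvaginSystem) (hCGS : CGSHowardDivisibilityPLocalized) (hMZ : MastellaZermanHowardDivisibility)
    (hEven : ∀ (W : WeierstrassCurve ℚ) [W.IsElliptic] [W.IsGloballyMinimal] (p : ℕ) [Fact p.Prime]
      [NeZero (W.conductorNorm ℤ)] (K : Type) [Field K] [NumberField K],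
      ClassX10 W p → ¬ Surj W 3 → ¬ W.HasCM →
      IsImaginaryQuadratic K → NumberField.discr K ≠ -3 → NumberField.discr K ≠ -4 →
      SatisfiesHeegnerHypothesis (W.conductorNorm ℤ) K → SatisfiesHeegnerHypothesis p K →
      ∀ (κ : ZpExtension K p), κ.IsAnticyclotomic → ∀ (γ : Field.absoluteGaloisGroup K),
      κ.IsTopGenerator γ →
      ∀ (Dt : ModularParametrizationData W (W.conductorNorm ℤ))
        (H : HeegnerDatum (W.conductorNorm ℤ) (NumberField.discr K)) (ιC : K →+* ℂ),
      ¬ Odd (NumberField.discr K) → p ∣ NumberField.classNumber K →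
      ∃ (jbar : AlgebraicClosure K →+* ℂ) (D : (W.baseChange K).LambdaAdicSelmerData κ γ)
        (F : HeegnerFamily (W.conductorNorm ℤ) W K κ jbar) (X : (W.baseChange K).SelmerDualData κ γ),
        heegnerCharIdeal D F ^ 2 ≤
          Module.charIdeal (IwasawaAlgebra p) (Submodule.torsion (IwasawaAlgebra p) X.X)) :
    HowardContainmentAnyClassNumberX10b := by
  intro W _ _ p _ _ K _ _ hX hns hcm hKq h3 h4 hHN hHp κ hκ γ hγ Dt H ιC
  by_cases hodd : Odd (NumberField.discr K)
  · exact howardContainmentAnyClassNumberX10b_oddDisc_of_kolyvaginSystemLeaf_of_cgs hK hCGS W p K hX hns hcm hKq h3 h4 hHN hHp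
      κ hκ γ hγ Dt H ιC hodd
  · by_cases hh : p ∣ NumberField.classNumber K
    · exact hEven W p K hX hns hcm hKq h3 h4 hHN hHp κ hκ γ hγ Dt H ιC hodd hh
    · have h46 : MastellaZerman2026.cor46_howardDivisibility_of_scalarImage.{0} := hMZ
      exact Summit.BirchSwinnertonDyer.BirchSwinnertonDyer.Rank1Residual.X10.heegnerContainment_of_cor46_of_not_surj
        h46 hX hns hcm hKq h3 h4 hHN hHp hh κ hκ γ hγ Dt H ιC

end Summit.BirchSwinnertonDyer.BirchSwinnertonDyer.Theorems.PrintX10bOfKSLeafOddDisc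

end
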